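import Mathlib
import Literature.Combinatorics.Expanders.Concentrator

/-!
# `DivisionGap.PerMultiplesHard` (stmt-ValiantsHypothesis-5068), line `uncharged-face-walk`:
stub `stub_levelEntropy` — small levels are paid by the multinomial

For level sizes `k v` (`v ∈ s`) with total `K = Σ_{v ∈ s} k v`, call a level SMALL when
`M · k v < K`, and let `S` be the total size of the small levels.  Then
`M ^ S · Π_{v ∈ s} (k v)! ≤ 9 ^ S · K!` (in fact with `3` in place of `9`).

Proof (elementary, Mathlib only).  Let `B := K - S` be the total size of the big levels.
* `Π_big (k v)! ≤ B!` (`Nat.prod_factorial_dvd_factorial_sum`);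
* `M ^ S · Π_small (k v)! = Π_small M ^ {k v} (k v)! ≤ Π_small (M k v) ^ {k v} ≤ Π_small K ^ {k v} = K ^ S`
  (`Nat.factorial_le_pow` and `M k v < K` on small levels);
* so the left-hand side is at most `K ^ S · B!`, and `K ^ S · B! ≤ 3 ^ S · K!`: since
  `K! = K.descFactorial S · B!` it suffices that `K ^ S ≤ 3 ^ S · K.descFactorial S`, which follows from
  `K ^ S · S! ≤ K.descFactorial S · S ^ S` (termwise `K (S - j) ≤ (K - j) S` for `j < S ≤ K`) and the crude
  Stirling bound `S ^ S ≤ 3 ^ S · S!` (the landed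
  `Literature.Combinatorics.Expanders.pow_self_le_three_pow_mul_factorial`: `S ^ S / S! ≤ e ^ S < 3 ^ S`).
-/

-- `Summit.ValiantsHypothesis.ValiantsHypothesis.…` is the tree's mandated layout (Sub = Summit).
set_option linter.dupNamespace false

namespace Summit.ValiantsHypothesis.ValiantsHypothesis.Theorems.DivisionGap.PerMultiplesHard.LevelEntropy

open Finset Literature.Combinatorics.Expanders

/-- For `S ≤ K` and every `j ≤ S`: `K ^ j * S.descFactorial j ≤ K.descFactorial j * S ^ j`
(termwise, `K * (S - i) ≤ (K - i) * S` for `i < S`). -/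
theorem pow_mul_descFactorial_le {K S : ℕ} (hSK : S ≤ K) :
    ∀ j, j ≤ S → K ^ j * S.descFactorial j ≤ K.descFactorial j * S ^ j := by
  intro j
  induction j with
  | zero => intro _; simp
  | succ j ih =>
    intro hj
    have hjS : j < S := hj
    have step : K * (S - j) ≤ (K - j) * S := by
      obtain ⟨a, rfl⟩ := Nat.exists_eq_add_of_lt hjS
      obtain ⟨b, rfl⟩ := Nat.exists_eq_add_of_le hSK
      have e1 : j + a + 1 - j = a + 1 := by omega
      have e2 : j + a + 1 + b - j = a + 1 + b := by omega
      rw [e1, e2]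
      nlinarith [Nat.zero_le (b * j)]
    calc K ^ (j + 1) * S.descFactorial (j + 1)
        = (K * (S - j)) * (K ^ j * S.descFactorial j) := by
          rw [pow_succ, Nat.descFactorial_succ]; ring
      _ ≤ ((K - j) * S) * (K.descFactorial j * S ^ j) :=
          Nat.mul_le_mul step (ih hjS.le)
      _ = K.descFactorial (j + 1) * S ^ (j + 1) := by
          rw [pow_succ, Nat.descFactorial_succ]; ring

/-- For `S ≤ K`: `K ^ S ≤ 3 ^ S * K.descFactorial S`. -/
theorem pow_le_three_pow_mul_descFactorial {K S : ℕ} (hSK : S ≤ K) :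
    K ^ S ≤ 3 ^ S * K.descFactorial S := by
  have hB := pow_mul_descFactorial_le hSK S le_rfl
  rw [Nat.descFactorial_self] at hB
  have h : K ^ S * S.factorial ≤ (3 ^ S * K.descFactorial S) * S.factorial :=
    calc K ^ S * S.factorial ≤ K.descFactorial S * S ^ S := hB
      _ ≤ K.descFactorial S * (3 ^ S * S.factorial) :=
          Nat.mul_le_mul_left _ (pow_self_le_three_pow_mul_factorial S)
      _ = (3 ^ S * K.descFactorial S) * S.factorial := by ring
  exact Nat.le_of_mul_le_mul_right h (Nat.factorial_pos S)

/-- `(S + B) ^ S * B! ≤ 3 ^ S * (S + B)!`. -/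
theorem pow_mul_factorial_le (S B : ℕ) :
    (S + B) ^ S * B.factorial ≤ 3 ^ S * (S + B).factorial := by
  have h := pow_le_three_pow_mul_descFactorial (Nat.le_add_right S B)
  have hfact : (S + B).factorial = (S + B).descFactorial S * B.factorial := by
    have e := Nat.factorial_mul_descFactorial (Nat.le_add_right S B)
    rw [Nat.add_sub_cancel_left] at e
    rw [← e]; ring
  rw [hfact]
  calc (S + B) ^ S * B.factorial ≤ (3 ^ S * (S + B).descFactorial S) * B.factorial :=
        Nat.mul_le_mul_right _ h
    _ = 3 ^ S * ((S + B).descFactorial S * B.factorial) := by ring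

/-- The level-entropy bound with the total `K` abstracted: if `Σ_{v ∈ s} k v = K` then
`M ^ S * Π_{v ∈ s} (k v)! ≤ 9 ^ S * K!`, where `S` is the total size of the levels with `M * k v < K`. -/
theorem levelEntropy_of_sum_eq (M K : ℕ) (s : Finset ℕ) (k : ℕ → ℕ) (hK : ∑ u ∈ s, k u = K) :
    M ^ (∑ v ∈ s.filter (fun v => M * k v < K), k v) * ∏ v ∈ s, (k v).factorial ≤
      9 ^ (∑ v ∈ s.filter (fun v => M * k v < K), k v) * K.factorial := by
  set S := ∑ v ∈ s.filter (fun v => M * k v < K), k v with hS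
  set B := ∑ v ∈ s.filter (fun v => ¬ M * k v < K), k v with hB
  have hSB : S + B = K := by
    rw [hS, hB, Finset.sum_filter_add_sum_filter_not, hK]
  -- the big levels: a product of factorials is at most the factorial of the sum
  have hbig : ∏ v ∈ s.filter (fun v => ¬ M * k v < K), (k v).factorial ≤ B.factorial :=
    Nat.le_of_dvd (Nat.factorial_pos _) (Nat.prod_factorial_dvd_factorial_sum _ _)
  -- the small levels: `M ^ {k v} (k v)! ≤ (M k v) ^ {k v} ≤ K ^ {k v}`
  have hsmall : M ^ S * ∏ v ∈ s.filter (fun v => M * k v < K), (k v).factorial ≤ K ^ S := by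
    rw [hS, ← Finset.prod_pow_eq_pow_sum, ← Finset.prod_pow_eq_pow_sum, ← Finset.prod_mul_distrib]
    refine Finset.prod_le_prod (fun _ _ => Nat.zero_le _) fun v hv => ?_
    have hv' : M * k v < K := (Finset.mem_filter.1 hv).2
    calc M ^ k v * (k v).factorial ≤ M ^ k v * (k v) ^ (k v) :=
          Nat.mul_le_mul_left _ (Nat.factorial_le_pow (k v))
      _ = (M * k v) ^ (k v) := (mul_pow _ _ _).symm
      _ ≤ K ^ k v := Nat.pow_le_pow_left hv'.le _
  calc M ^ S * ∏ v ∈ s, (k v).factorial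
      = (M ^ S * ∏ v ∈ s.filter (fun v => M * k v < K), (k v).factorial) *
          ∏ v ∈ s.filter (fun v => ¬ M * k v < K), (k v).factorial := by
        rw [← Finset.prod_filter_mul_prod_filter_not s (fun v => M * k v < K)]; ring
    _ ≤ K ^ S * B.factorial := Nat.mul_le_mul hsmall hbig
    _ = (S + B) ^ S * B.factorial := by rw [hSB]
    _ ≤ 3 ^ S * (S + B).factorial := pow_mul_factorial_le S B
    _ = 3 ^ S * K.factorial := by rw [hSB]
    _ ≤ 9 ^ S * K.factorial :=
        Nat.mul_le_mul_right _ (Nat.pow_le_pow_left (by norm_num) _)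

/-- **Level entropy (stub `stub_levelEntropy`).**  For level sizes `k v` (`v ∈ s`) with total
`K = Σ_{v ∈ s} k v`, a level being SMALL when `M · k v < K` and `S` the total size of the small levels:
`M ^ S · Π_{v ∈ s} (k v)! ≤ 9 ^ S · K!`. [folklore] -/
theorem stub_levelEntropy :
    ∀ (M : ℕ) (s : Finset ℕ) (k : ℕ → ℕ),
      M ^ (∑ v ∈ s.filter (fun v => M * k v < ∑ u ∈ s, k u), k v) * ∏ v ∈ s, (k v).factorial ≤
        9 ^ (∑ v ∈ s.filter (fun v => M * k v < ∑ u ∈ s, k u), k v) * (∑ v ∈ s, k v).factorial :=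
  fun M s k => levelEntropy_of_sum_eq M _ s k rfl

end Summit.ValiantsHypothesis.ValiantsHypothesis.Theorems.DivisionGap.PerMultiplesHard.LevelEntropy
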